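import Summits.QuantumFields.BalabanUV.Beta.D1BFx.GradedBiBubbleTerms

/-!
# `BalabanUV.Beta.D1BFx.GradedBiBubbleMoving` — road «BF-x» for binder row D1, «A3.c ∕ L-X TAILS» PART II (F3b): the unfolding of part (F3) with the
# MOVING-END COUNT — the first vertex's differences land on the two ends that move with it

HONEST DEPENDENCY (page 1, mandatory): continuum YM on T⁴ ⇐ BetaPertH ∧ nine spine estimates (0/9 proved); BetaPertH ⇐ (D1) ∧ (D4) ∧
CAP+tail; G-an2-4 gates asym, D1 and NE2/3/4.  HONEST FRAMING (cell contract, verbatim): «discharging `BetaPertH` makes Bałaban's UV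
stability UNCONDITIONAL — a real constructive-QFT result; it is NOT the continuum limit and NOT the Clay problem.»  THIS MODULE DISCHARGES
NOTHING of the wall: [folklore] list bookkeeping — the induction of part (F3) `GradedBiBubbleTerms` run again with one more counter.  No `def`, no
`Prop` minted, nothing cited, 0 sorry.  0 wall binders; NOT an A3.c row, NOT (K), NOT D1, NOT `BetaPertH`, NOT continuum, NOT Clay.

ABSOLUTE RULE (cell charter, verbatim): «No internally-minted statement may enter as a cited fact. Every hypothesis is either kernel-proved in
this package or a verbatim quotation of a PUBLISHED theorem with page reference. The manuscript(s) under audit are NOT citable for their own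
disputed steps — they are the thing under adjudication; programme-internal (2001/route/tribunal) claims are never citable.»

WHY (this lineage's N-d1leaf03g12-2): in the road's words the first vertex sits at the moving point `b + w`, the second at `b`; a term whose steps
all sit on ONE leg needs one summation by parts in `w`, which can only move a step of an end that moves with `w` — the first leg's second argument
(`dA`) or the second leg's first argument (`dB`).  Part (F3) recorded only the total `n₁ + n₂ ≤ t.len`; here the same induction also records
`n₁ ≤ |t.dA| + |t.dB|` (row moves of the first vertex go to `dA`, column moves to `dB`; the second vertex's moves go to the static ends `sA`, `sB`).
* [folklore] `exists_eterms₂_right_mov`, `exists_eterms₂_aux_mov`, **`exists_eterms₂_of_graded_mov`**: `Graded n₁ V → Graded n₂ W → ∃ Lst, (∀ t ∈ Lst,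
  unit steps ∧ n₁ + n₂ ≤ t.len ∧ n₁ ≤ |t.dA| + |t.dB|) ∧ ∀ A B z z', bub₂ A B z z' V W = Σ_{t ∈ Lst} t.eval A B z z'`.
Unit `b2b-balaban-beta-d1-formalise-leaf-03` (gen 12), D1 formalisation swarm; `LEAVES-BFx.md` row «A3.c ∕ L-X TAILS» PART II (F3b).
-/

noncomputable section

namespace Summit.QuantumFields.BalabanUV.Beta.D1BFx.GradedBiBubbleMoving

open Literature.MathematicalPhysics.QuantumFieldTheory.Balaban1983to89.Beta
open ExpKernelCalculus (Site MKer)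
open DyadicShell (Pt)
open GradedBubbles (LP Stn rowSh colSh smulS rowDiff colDiff Graded IsStep)
open BiBubbleTable (bub₂ bub₂_rowSh_left bub₂_colSh_left bub₂_rowSh_right bub₂_colSh_right bub₂_rowDiff_left bub₂_colDiff_left
  bub₂_rowDiff_right bub₂_colDiff_right bub₂_append_left bub₂_append_right bub₂_smul_left bub₂_smul_right)
open GradedBiBubbleTerms (legOf ETerm₂ baseTerms₂ legOf_nil shRk_legOf shLk_legOf shRk_sub_legOf shLk_sub_legOf bub₂_legOf_eq_sum mem_baseTerms₂ sum_map_eval_smul)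

variable {I : Type*} [Fintype I]

/-- [folklore] **THE UNFOLDING WITH THE SECOND VERTEX GRADED** (inner induction; raw first list, pending leg operations). -/
theorem exists_eterms₂_right_mov (V : Stn I) {n₂ : ℕ} {W : Stn I} (hW : Graded n₂ W) :
    ∀ (cLA cRA cLB cRB : Pt) (sA dA dB sB : List Pt), (∀ e ∈ sA ++ dA ++ dB ++ sB, IsStep e) →
      ∃ Lst : List (ETerm₂ I), (∀ t ∈ Lst, (∀ e ∈ t.sA ++ t.dA ++ t.dB ++ t.sB, IsStep e) ∧ n₂ + (sA.length + dA.length + dB.length + sB.length) ≤ t.len ∧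
          dA.length + dB.length ≤ t.dA.length + t.dB.length) ∧
        ∀ (A B : MKer 4 I) (z z' : Pt), bub₂ (legOf A cLA cRA sA dA) (legOf B cLB cRB dB sB) z z' V W = (Lst.map (ETerm₂.eval A B z z')).sum := by
  induction hW with
  | zero W =>
      intro cLA cRA cLB cRB sA dA dB sB hs
      refine ⟨baseTerms₂ cLA cRA cLB cRB sA dA dB sB V W, fun t ht => ?_, fun A B z z' => bub₂_legOf_eq_sum A B z z' cLA cRA cLB cRB sA dA dB sB V W⟩
      obtain ⟨e₁, e₂, e₃, e₄⟩ := mem_baseTerms₂ ht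
      refine ⟨fun e he => hs e (by rw [e₁, e₂, e₃, e₄] at he; exact he), by simp only [ETerm₂.len, e₁, e₂, e₃, e₄]; omega, by rw [e₂, e₃]⟩
  | weaken _ ih =>
      intro cLA cRA cLB cRB sA dA dB sB hs
      obtain ⟨Lst, hL, hid⟩ := ih cLA cRA cLB cRB sA dA dB sB hs
      exact ⟨Lst, fun t ht => ⟨(hL t ht).1, by have := (hL t ht).2.1; omega, by have := (hL t ht).2.2; omega⟩, hid⟩
  | @rowDiff n W e he _ ih =>
      -- row of the second vertex ⇒ the second leg's SECOND argument
      intro cLA cRA cLB cRB sA dA dB sB hs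
      obtain ⟨Lst, hL, hid⟩ := ih cLA cRA cLB cRB sA dA dB (e :: sB) (fun e' he' => by
        simp only [List.mem_append, List.mem_cons] at he' hs ⊢
        rcases he' with ((h | h) | h) | h | h
        · exact hs e' (Or.inl (Or.inl (Or.inl h)))
        · exact hs e' (Or.inl (Or.inl (Or.inr h)))
        · exact hs e' (Or.inl (Or.inr h))
        · rw [h]; exact he
        · exact hs e' (Or.inr h))
      refine ⟨Lst, fun t ht => ⟨(hL t ht).1, by have := (hL t ht).2.1; simp only [List.length_cons] at this; omega,
        (hL t ht).2.2⟩, fun A B z z' => ?_⟩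
      rw [bub₂_rowDiff_right, shRk_sub_legOf]
      exact hid A B z z'
  | @colDiff n W e he _ ih =>
      -- column of the second vertex ⇒ the first leg's FIRST argument
      intro cLA cRA cLB cRB sA dA dB sB hs
      obtain ⟨Lst, hL, hid⟩ := ih cLA cRA cLB cRB (e :: sA) dA dB sB (fun e' he' => by
        simp only [List.mem_append, List.mem_cons] at he' hs ⊢
        rcases he' with (((h | h) | h) | h) | h
        · rw [h]; exact he
        · exact hs e' (Or.inl (Or.inl (Or.inl h)))
        · exact hs e' (Or.inl (Or.inl (Or.inr h)))
        · exact hs e' (Or.inl (Or.inr h))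
        · exact hs e' (Or.inr h))
      refine ⟨Lst, fun t ht => ⟨(hL t ht).1, by have := (hL t ht).2.1; simp only [List.length_cons] at this; omega,
        (hL t ht).2.2⟩, fun A B z z' => ?_⟩
      rw [bub₂_colDiff_right, shLk_sub_legOf]
      exact hid A B z z'
  | @rowSh n W e _ ih =>
      intro cLA cRA cLB cRB sA dA dB sB hs
      obtain ⟨Lst, hL, hid⟩ := ih cLA cRA cLB (e + cRB) sA dA dB sB hs
      refine ⟨Lst, hL, fun A B z z' => ?_⟩
      rw [bub₂_rowSh_right, shRk_legOf]
      exact hid A B z z'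
  | @colSh n W e _ ih =>
      intro cLA cRA cLB cRB sA dA dB sB hs
      obtain ⟨Lst, hL, hid⟩ := ih (e + cLA) cRA cLB cRB sA dA dB sB hs
      refine ⟨Lst, hL, fun A B z z' => ?_⟩
      rw [bub₂_colSh_right, shLk_legOf]
      exact hid A B z z'
  | @append n W W' _ _ ih ih' =>
      intro cLA cRA cLB cRB sA dA dB sB hs
      obtain ⟨Lst, hL, hid⟩ := ih cLA cRA cLB cRB sA dA dB sB hs
      obtain ⟨Lst', hL', hid'⟩ := ih' cLA cRA cLB cRB sA dA dB sB hs
      refine ⟨Lst ++ Lst', fun t ht => ?_, fun A B z z' => ?_⟩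
      · rcases List.mem_append.mp ht with ht | ht
        · exact hL t ht
        · exact hL' t ht
      · rw [bub₂_append_right, hid, hid', List.map_append, List.sum_append]
  | @smul n W r _ ih =>
      intro cLA cRA cLB cRB sA dA dB sB hs
      obtain ⟨Lst, hL, hid⟩ := ih cLA cRA cLB cRB sA dA dB sB hs
      refine ⟨Lst.map (ETerm₂.smul r), fun t ht => ?_, fun A B z z' => ?_⟩
      · obtain ⟨t', ht', rfl⟩ := List.mem_map.mp ht
        exact ⟨(hL t' ht').1, by rw [ETerm₂.len_smul]; exact (hL t' ht').2.1, (hL t' ht').2.2⟩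
      · rw [bub₂_smul_right, hid, sum_map_eval_smul]

/-- [folklore] **THE UNFOLDING WITH BOTH VERTICES GRADED** (outer induction). -/
theorem exists_eterms₂_aux_mov {n₁ : ℕ} {V : Stn I} (hV : Graded n₁ V) :
    ∀ {n₂ : ℕ} {W : Stn I}, Graded n₂ W → ∀ (cLA cRA cLB cRB : Pt) (sA dA dB sB : List Pt), (∀ e ∈ sA ++ dA ++ dB ++ sB, IsStep e) →
      ∃ Lst : List (ETerm₂ I), (∀ t ∈ Lst, (∀ e ∈ t.sA ++ t.dA ++ t.dB ++ t.sB, IsStep e) ∧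
          n₁ + n₂ + (sA.length + dA.length + dB.length + sB.length) ≤ t.len ∧ n₁ + (dA.length + dB.length) ≤ t.dA.length + t.dB.length) ∧
        ∀ (A B : MKer 4 I) (z z' : Pt), bub₂ (legOf A cLA cRA sA dA) (legOf B cLB cRB dB sB) z z' V W = (Lst.map (ETerm₂.eval A B z z')).sum := by
  induction hV with
  | zero V =>
      intro n₂ W hW cLA cRA cLB cRB sA dA dB sB hs
      obtain ⟨Lst, hL, hid⟩ := exists_eterms₂_right_mov V hW cLA cRA cLB cRB sA dA dB sB hs
      exact ⟨Lst, fun t ht => ⟨(hL t ht).1, by have := (hL t ht).2.1; omega, by have := (hL t ht).2.2; omega⟩, hid⟩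
  | weaken _ ih =>
      intro n₂ W hW cLA cRA cLB cRB sA dA dB sB hs
      obtain ⟨Lst, hL, hid⟩ := ih hW cLA cRA cLB cRB sA dA dB sB hs
      exact ⟨Lst, fun t ht => ⟨(hL t ht).1, by have := (hL t ht).2.1; omega, by have := (hL t ht).2.2; omega⟩, hid⟩
  | @rowDiff n V e he _ ih =>
      -- row of the first vertex ⇒ the first leg's SECOND argument
      intro n₂ W hW cLA cRA cLB cRB sA dA dB sB hs
      obtain ⟨Lst, hL, hid⟩ := ih hW cLA cRA cLB cRB sA (e :: dA) dB sB (fun e' he' => by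
        simp only [List.mem_append, List.mem_cons] at he' hs ⊢
        rcases he' with ((h | h | h) | h) | h
        · exact hs e' (Or.inl (Or.inl (Or.inl h)))
        · rw [h]; exact he
        · exact hs e' (Or.inl (Or.inl (Or.inr h)))
        · exact hs e' (Or.inl (Or.inr h))
        · exact hs e' (Or.inr h))
      refine ⟨Lst, fun t ht => ⟨(hL t ht).1, by have := (hL t ht).2.1; simp only [List.length_cons] at this; omega,
        by have := (hL t ht).2.2; simp only [List.length_cons] at this; omega⟩, fun A B z z' => ?_⟩
      rw [bub₂_rowDiff_left, shRk_sub_legOf]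
      exact hid A B z z'
  | @colDiff n V e he _ ih =>
      -- column of the first vertex ⇒ the second leg's FIRST argument
      intro n₂ W hW cLA cRA cLB cRB sA dA dB sB hs
      obtain ⟨Lst, hL, hid⟩ := ih hW cLA cRA cLB cRB sA dA (e :: dB) sB (fun e' he' => by
        simp only [List.mem_append, List.mem_cons] at he' hs ⊢
        rcases he' with ((h | h) | h | h) | h
        · exact hs e' (Or.inl (Or.inl (Or.inl h)))
        · exact hs e' (Or.inl (Or.inl (Or.inr h)))
        · rw [h]; exact he
        · exact hs e' (Or.inl (Or.inr h))
        · exact hs e' (Or.inr h))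
      refine ⟨Lst, fun t ht => ⟨(hL t ht).1, by have := (hL t ht).2.1; simp only [List.length_cons] at this; omega,
        by have := (hL t ht).2.2; simp only [List.length_cons] at this; omega⟩, fun A B z z' => ?_⟩
      rw [bub₂_colDiff_left, shLk_sub_legOf]
      exact hid A B z z'
  | @rowSh n V e _ ih =>
      intro n₂ W hW cLA cRA cLB cRB sA dA dB sB hs
      obtain ⟨Lst, hL, hid⟩ := ih hW cLA (e + cRA) cLB cRB sA dA dB sB hs
      refine ⟨Lst, hL, fun A B z z' => ?_⟩
      rw [bub₂_rowSh_left, shRk_legOf]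
      exact hid A B z z'
  | @colSh n V e _ ih =>
      intro n₂ W hW cLA cRA cLB cRB sA dA dB sB hs
      obtain ⟨Lst, hL, hid⟩ := ih hW cLA cRA (e + cLB) cRB sA dA dB sB hs
      refine ⟨Lst, hL, fun A B z z' => ?_⟩
      rw [bub₂_colSh_left, shLk_legOf]
      exact hid A B z z'
  | @append n V V' _ _ ih ih' =>
      intro n₂ W hW cLA cRA cLB cRB sA dA dB sB hs
      obtain ⟨Lst, hL, hid⟩ := ih hW cLA cRA cLB cRB sA dA dB sB hs
      obtain ⟨Lst', hL', hid'⟩ := ih' hW cLA cRA cLB cRB sA dA dB sB hs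
      refine ⟨Lst ++ Lst', fun t ht => ?_, fun A B z z' => ?_⟩
      · rcases List.mem_append.mp ht with ht | ht
        · exact hL t ht
        · exact hL' t ht
      · rw [bub₂_append_left, hid, hid', List.map_append, List.sum_append]
  | @smul n V r _ ih =>
      intro n₂ W hW cLA cRA cLB cRB sA dA dB sB hs
      obtain ⟨Lst, hL, hid⟩ := ih hW cLA cRA cLB cRB sA dA dB sB hs
      refine ⟨Lst.map (ETerm₂.smul r), fun t ht => ?_, fun A B z z' => ?_⟩
      · obtain ⟨t', ht', rfl⟩ := List.mem_map.mp ht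
        exact ⟨(hL t' ht').1, by rw [ETerm₂.len_smul]; exact (hL t' ht').2.1, (hL t' ht').2.2⟩
      · rw [bub₂_smul_left, hid, sum_map_eval_smul]

/-- [folklore] **THE UNFOLDING WITH THE MOVING-END COUNT.**  For `Graded n₁ V`, `Graded n₂ W`: a finite list of elementary two-point terms with unit
steps, `n₁ + n₂ ≤ t.len` AND `n₁ ≤ |t.dA| + |t.dB|`, with `bub₂ A B z z' V W = Σ_t t.eval A B z z'` for all legs and base points. -/
theorem exists_eterms₂_of_graded_mov {n₁ : ℕ} {V : Stn I} (hV : Graded n₁ V) {n₂ : ℕ} {W : Stn I} (hW : Graded n₂ W) :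
    ∃ Lst : List (ETerm₂ I), (∀ t ∈ Lst, (∀ e ∈ t.sA ++ t.dA ++ t.dB ++ t.sB, IsStep e) ∧ n₁ + n₂ ≤ t.len ∧ n₁ ≤ t.dA.length + t.dB.length) ∧
      ∀ (A B : MKer 4 I) (z z' : Pt), bub₂ A B z z' V W = (Lst.map (ETerm₂.eval A B z z')).sum := by
  obtain ⟨Lst, hL, hid⟩ := exists_eterms₂_aux_mov hV hW 0 0 0 0 [] [] [] [] (by simp)
  refine ⟨Lst, fun t ht => ⟨(hL t ht).1, by simpa using (hL t ht).2.1, by simpa using (hL t ht).2.2⟩, fun A B z z' => ?_⟩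
  have h := hid A B z z'
  rwa [legOf_nil, legOf_nil] at h

end Summit.QuantumFields.BalabanUV.Beta.D1BFx.GradedBiBubbleMoving

end
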